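import Summits.QuantumFields.YangMills.Theorems.LuscherReductionTwistedTraceScalingBOStiffDoor
import HarnessLib

/-!
# R62 — THE GAIN CEILING OF THE (B-ST) DOOR: `(1−δ)·c_J ≤ (1+η)·C_ν`, hence `θ_door = c_J/(C_ν P₀) ≤ (1+η)/((1−δ)P₀) ≤ (1+η)(1−ρ)/(1−δ)`
# (crux `LuscherReduction.TwistedTraceScaling`, stmt-QuantumFields-20203; a negative/tightness lemma on lane A's (B-ST) pen, door ✓p735077 `…BOStiffDoor`)

Lane A's ground-state/Poincaré route to the stiff brick `hST` of `…BORecordInputOfST.recordAnalyticInput_of_hST` (card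
`pub/ym-fleet/ym-luscher-20007-p1/Lines-BST-poincare.md`) closes the fibre coercivity through the DOOR
`StiffDoor.form_le_of_quasimode_of_comparison`: an UPPER QUASIMODE `(MΘ)(x) ≤ (1+η)Λ·Θ(x)w(x)` on the core `S`, a weight comparison
`Θ²w ≤ C_ν·D` on `S`, a ONE-SIDED kernel comparison `c_J·Λ·J₀ ≤ Θ M Θ` on `X × X` and a flat Poincaré inequality for `(D, J₀)` with constant `P₀`
give `⟨gΘ, M gΘ⟩ ≤ Λ[(1 + η − θ_door)‖gΘ‖²_w + θ_door·mean²/Z]` with the GAIN `θ_door := c_J/(C_ν P₀)`.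

THIS FILE (model-free, in the door's own variables): the three comparison constants are NOT independent.  Integrating the kernel comparison in `y`
and chaining it with the quasimode and the weight comparison at a single point `x ∈ S` with `D(x) > 0` gives

* ★★ `cJ_le_of_quasimode_of_comparison_at` — if the flat jump kernel keeps at least the fraction `1 − δ` of the flat mass at `x`,
  `(1−δ)·D(x) ≤ ∫ J₀(x,y) dy` (for the Mehler pair `J₀ = h₀Kh₀/λ₀`, `D = h₀²` of `…MehlerPoincare.mehler_poincare_normal` this is an EQUALITY with
  `δ = 0` on the whole space, and `δ` = the flat jump mass leaving the region `{Θ > 0}` when `J₀` is cut there — as `(J)` forces wherever `Θ = 0`,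
  e.g. off the `r_f`-ball of the frozen profile `Ω_c`), then `(1−δ)·c_J ≤ (1+η)·C_ν`;
* ★★ `doorGain_le` — consequently `θ_door = c_J/(C_ν P₀) ≤ (1+η)/((1−δ)·P₀)`: the door's gain never exceeds the quasimode slack times the flat
  Poincaré RATE `1/P₀`, whatever comparison data `(Θ, w, D, J₀, S)` are chosen;
* ★★ `doorGain_le_flatRate` — with a flat constant no better than the flat gap, `1/P₀ ≤ 1 − ρ` (`mehler_poincare_normal`: `P₀ = 1/(1−ρ)`,
  `ρ ≥ max_k r_k`), `θ_door ≤ (1+η)(1−ρ)/(1−δ)`;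
* ★ `doorCoefficient_ge` — the door's output coefficient obeys `1 + η − θ_door ≥ (1+η)(ρ−δ)/(1−δ)`: fed by the Mehler pair (`δ → 0`, `η → 0`) the
  door can certify at best `T(v) ≲ ρ·Λ‖v‖² = (max_k r_k)·Λ‖v‖²` on the BO-orthogonal sector — exactly the second stiff level, i.e. the ceiling
  `θ₀ < θ_S(L) = 1 − mehlerRatio (g₀ L)` of `…Negative.StiffGapCeiling` (R60) / `…Negative.TensorGapCeiling` (R61) / `…Negative.BOStiffBlockCeiling`
  (R61B), now reached from the METHOD side and without any model assumption on the true kernel;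
* ★ `doorGain_le_one_add` — in particular `θ_door ≤ (1+η)/(1−δ)` always (`P₀ ≥ 1` is not needed for this: take the rate bound `1/P₀ ≤ 1`).

The ceiling is ATTAINED by the flat pair itself (`M` with `MΘ = ΛΘw` exactly, `D := Θ²w`, `J₀ := ΘMΘ/Λ`: `η = δ = 0`, `c_J = C_ν = 1`), so nothing
sharper holds at this generality.

HONEST FRAMING: a limitation-of-method (tightness) lemma about an abstract, correct door; NOT a refutation of `hST`, of (B-ST) or of the crux.  Lane A's
announced target `θ₀(L) := θ_*(L)/4`, `θ_* = c_J/(C_ν P₀)`, lies inside the ceiling.  What the lemma fixes for the record: (i) along the Poincaré route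
`hST` is obtainable only with `θ₀ ≤ (1+η)θ_S(L)/(1−δ) → θ_S(L)` (`0.83` at `L = 2`, `< 1/2` for `L ≥ 9`, `∼ 2π/L`), so the route cannot evade the
stiff-gap ceiling by a clever choice of comparison data; (ii) the two slack factors any feeding must keep BELOW the gain — the quasimode slack `η(β)`
(lane A: `O(β^{1/2−3s}ℓ^C) → 0` for `s > 1/6`) and the killed flat mass `δ` (`e^{−cℓ²}` for the `r_f`-ball) — are now named in the door's currency.
Stub of a child of the CONDITIONAL reduction route R2b1 (skeleton «twolattice»); not infinite volume, not a mass gap, not Clay.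
References: Holley–Stroock, J. Stat. Phys. 46 (1987) 1159 (comparison of Dirichlet forms); Helffer, *Spectral theory and its applications* (2013) §7;
Simon, Ann. Phys. 146 (1983) 209 (semiclassical stiff gaps); Lüscher, Nucl. Phys. B219 (1983) 233, §3.
-/

set_option autoImplicit false

noncomputable section

open MeasureTheory

namespace Summit.QuantumFields.YangMills.Theorems.TwistedTraceScaling.Negative.R62

open Summit.QuantumFields.YangMills.Theorems.FemtoTransferGap

variable {X : Type*} [MeasurableSpace X] {μ : Measure X} [IsFiniteMeasure μ]
variable {M J₀ : X → X → ℝ} {Θ w D : X → ℝ} {CM CΘ CJ : ℝ} {S : Set X} {η Λ Cν cJ δ : ℝ}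

/-- ★★ **The comparison constants of the door are linked: `(1−δ)·c_J ≤ (1+η)·C_ν`.**  Hypotheses `hq`, `hν`, `hJ` are LITERALLY those of
`StiffDoor.form_le_of_quasimode_of_comparison`; the only additions are one point `x ∈ S` with `D x > 0` at which the flat jump kernel keeps the
fraction `1 − δ` of the flat mass, `(1−δ)·D x ≤ ∫ J₀ x y ∂μ` (equality, `δ = 0`, for the Mehler pair), and `0 ≤ 1 + η`. [cite: HolleyStroock1987, §1] -/
theorem cJ_le_of_quasimode_of_comparison_at (hM : Measurable (Function.uncurry M)) (hMb : ∀ x y, |M x y| ≤ CM)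
    (hΘb : ∀ x, |Θ x| ≤ CΘ) (hΘ0 : ∀ x, 0 ≤ Θ x) (hΘ : Measurable Θ)
    (hJ₀ : Measurable (Function.uncurry J₀)) (hJ₀b : ∀ x y, |J₀ x y| ≤ CJ) (hΛ : 0 < Λ) (hη : 0 ≤ 1 + η)
    (hq : ∀ x ∈ S, ∫ y, M x y * Θ y ∂μ ≤ (1 + η) * Λ * (Θ x * w x)) (hν : ∀ x ∈ S, Θ x ^ 2 * w x ≤ Cν * D x)
    (hJ : ∀ x y, cJ * (Λ * J₀ x y) ≤ Θ x * M x y * Θ y) (hcJ : 0 < cJ)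
    {x : X} (hx : x ∈ S) (hDx : 0 < D x) (hmarg : (1 - δ) * D x ≤ ∫ y, J₀ x y ∂μ) :
    (1 - δ) * cJ ≤ (1 + η) * Cν := by
  -- the two `y`-integrands are bounded measurable, hence integrable on the finite measure space
  have mJ : Measurable fun y => J₀ x y := hJ₀.comp measurable_prodMk_left
  have mM : Measurable fun y => M x y * Θ y := (hM.comp measurable_prodMk_left).mul hΘ
  have hCΘ : 0 ≤ CΘ := (abs_nonneg _).trans (hΘb x)
  have i1 : Integrable (fun y => cJ * (Λ * J₀ x y)) μ :=
    integrable_of_measurable_abs_le μ (mJ.const_mul Λ |>.const_mul cJ) (C := |cJ| * (|Λ| * CJ)) fun y => by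
      rw [abs_mul, abs_mul]
      exact mul_le_mul_of_nonneg_left (mul_le_mul_of_nonneg_left (hJ₀b x y) (abs_nonneg _)) (abs_nonneg _)
  have i2 : Integrable (fun y => Θ x * M x y * Θ y) μ :=
    integrable_of_measurable_abs_le μ ((measurable_const.mul (hM.comp measurable_prodMk_left)).mul hΘ) (C := CΘ * CM * CΘ) fun y => by
      rw [abs_mul, abs_mul]
      exact mul_le_mul (mul_le_mul (hΘb x) (hMb x y) (abs_nonneg _) hCΘ) (hΘb y) (abs_nonneg _) (mul_nonneg hCΘ ((abs_nonneg _).trans (hMb x y)))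
  -- integrate the kernel comparison in `y`
  have h1 : ∫ y, cJ * (Λ * J₀ x y) ∂μ ≤ ∫ y, Θ x * M x y * Θ y ∂μ := integral_mono i1 i2 fun y => hJ x y
  have e1 : ∫ y, cJ * (Λ * J₀ x y) ∂μ = cJ * Λ * ∫ y, J₀ x y ∂μ := by
    rw [integral_const_mul, integral_const_mul, mul_assoc]
  have e2 : ∫ y, Θ x * M x y * Θ y ∂μ = Θ x * ∫ y, M x y * Θ y ∂μ := by
    rw [← integral_const_mul]
    exact integral_congr_ae (ae_of_all _ fun y => by ring)
  -- chain with the quasimode bound and the weight comparison at `x`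
  have h4 : cJ * Λ * ((1 - δ) * D x) ≤ (1 + η) * Λ * (Cν * D x) :=
    calc cJ * Λ * ((1 - δ) * D x) ≤ cJ * Λ * ∫ y, J₀ x y ∂μ := mul_le_mul_of_nonneg_left hmarg (mul_nonneg hcJ.le hΛ.le)
      _ = ∫ y, cJ * (Λ * J₀ x y) ∂μ := e1.symm
      _ ≤ ∫ y, Θ x * M x y * Θ y ∂μ := h1
      _ = Θ x * ∫ y, M x y * Θ y ∂μ := e2
      _ ≤ Θ x * ((1 + η) * Λ * (Θ x * w x)) := mul_le_mul_of_nonneg_left (hq x hx) (hΘ0 x)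
      _ = (1 + η) * Λ * (Θ x ^ 2 * w x) := by ring
      _ ≤ (1 + η) * Λ * (Cν * D x) := mul_le_mul_of_nonneg_left (hν x hx) (mul_nonneg hη hΛ.le)
  -- divide by `Λ·D x > 0`
  have h5 : ((1 - δ) * cJ) * (Λ * D x) ≤ ((1 + η) * Cν) * (Λ * D x) := by nlinarith [h4]
  exact le_of_mul_le_mul_right h5 (mul_pos hΛ hDx)

/-- ★★ **THE DOOR'S GAIN CEILING**: `θ_door = c_J/(C_ν P₀) ≤ (1+η)/((1−δ)·P₀)` — the gain never exceeds the quasimode slack times the flat Poincaré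
rate, for every choice of comparison data. [cite: HolleyStroock1987, §1] -/
theorem doorGain_le (hlink : (1 - δ) * cJ ≤ (1 + η) * Cν) (hδ : δ < 1) (hCν : 0 < Cν) {P₀ : ℝ} (hP₀ : 0 < P₀) :
    cJ / (Cν * P₀) ≤ (1 + η) / ((1 - δ) * P₀) := by
  have hδ' : 0 < 1 - δ := by linarith
  rw [div_le_div_iff₀ (mul_pos hCν hP₀) (mul_pos hδ' hP₀)]
  nlinarith [mul_le_mul_of_nonneg_right hlink hP₀.le]

/-- ★★ **Gain versus the flat gap**: if the flat Poincaré constant is no better than the flat spectral gap, `1/P₀ ≤ 1 − ρ` (the Mehler pair: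
`P₀ = 1/(1−ρ)` with `ρ ≥ max_k r_k`, `…MehlerPoincare.mehler_poincare_normal`), then `θ_door ≤ (1+η)(1−ρ)/(1−δ)`. [cite: Helffer2013, §7] -/
theorem doorGain_le_flatRate (hlink : (1 - δ) * cJ ≤ (1 + η) * Cν) (hδ : δ < 1) (hη : 0 ≤ 1 + η) (hCν : 0 < Cν) {P₀ ρ : ℝ} (hP₀ : 0 < P₀)
    (hrate : 1 / P₀ ≤ 1 - ρ) : cJ / (Cν * P₀) ≤ (1 + η) * (1 - ρ) / (1 - δ) := by
  have hδ' : 0 < 1 - δ := by linarith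
  have h1 := doorGain_le hlink hδ hCν hP₀
  have h2 : (1 + η) / ((1 - δ) * P₀) = (1 + η) / (1 - δ) * (1 / P₀) := by
    field_simp
  have h3 : (1 + η) / (1 - δ) * (1 / P₀) ≤ (1 + η) / (1 - δ) * (1 - ρ) := mul_le_mul_of_nonneg_left hrate (div_nonneg hη hδ'.le)
  calc cJ / (Cν * P₀) ≤ (1 + η) / ((1 - δ) * P₀) := h1
    _ = (1 + η) / (1 - δ) * (1 / P₀) := h2
    _ ≤ (1 + η) / (1 - δ) * (1 - ρ) := h3
    _ = (1 + η) * (1 - ρ) / (1 - δ) := by ring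

/-- ★ **The door's output coefficient has a floor**: `1 + η − θ_door ≥ (1+η)(ρ−δ)/(1−δ)`.  Fed by the Mehler pair (`δ, η → 0`) the door certifies at
best `T ≲ ρ·Λ‖·‖²` on the BO-orthogonal sector — the second stiff level, i.e. the stiff-gap ceiling of R60/R61/R61B, reached from the method side.
[cite: Helffer2013, §7] -/
theorem doorCoefficient_ge (hlink : (1 - δ) * cJ ≤ (1 + η) * Cν) (hδ : δ < 1) (hη : 0 ≤ 1 + η) (hCν : 0 < Cν) {P₀ ρ : ℝ} (hP₀ : 0 < P₀)
    (hrate : 1 / P₀ ≤ 1 - ρ) : (1 + η) * (ρ - δ) / (1 - δ) ≤ 1 + η - cJ / (Cν * P₀) := by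
  have hδ' : 0 < 1 - δ := by linarith
  have h := doorGain_le_flatRate hlink hδ hη hCν hP₀ hrate
  have e : (1 + η) * (ρ - δ) / (1 - δ) = 1 + η - (1 + η) * (1 - ρ) / (1 - δ) := by
    field_simp
    ring
  rw [e]
  linarith

/-- ★ In particular `θ_door ≤ (1+η)/(1−δ)` whenever the flat rate is at most one, `1/P₀ ≤ 1` (`P₀ ≥ 1`, as for every Mehler pair). [folklore] -/
theorem doorGain_le_one_add (hlink : (1 - δ) * cJ ≤ (1 + η) * Cν) (hδ : δ < 1) (hη : 0 ≤ 1 + η) (hCν : 0 < Cν) {P₀ : ℝ} (hP₀ : 1 ≤ P₀) :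
    cJ / (Cν * P₀) ≤ (1 + η) / (1 - δ) := by
  have hP₀' : 0 < P₀ := by linarith
  have hrate : 1 / P₀ ≤ 1 - 0 := by rw [sub_zero, div_le_one hP₀']; exact hP₀
  have h := doorGain_le_flatRate hlink hδ hη hCν hP₀' hrate
  simpa using h

/-- ★★ **The chained form, in the door's full hypothesis list**: under the hypotheses of `StiffDoor.form_le_of_quasimode_of_comparison` plus the
flat-mass floor at one point of `S` and a flat constant no better than the flat gap, the door's gain is at most `(1+η)(1−ρ)/(1−δ)`.
[cite: HolleyStroock1987, §1] [cite: Helffer2013, §7] -/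
theorem doorGain_le_flatRate_of_comparison (hM : Measurable (Function.uncurry M)) (hMb : ∀ x y, |M x y| ≤ CM)
    (hΘb : ∀ x, |Θ x| ≤ CΘ) (hΘ0 : ∀ x, 0 ≤ Θ x) (hΘ : Measurable Θ)
    (hJ₀ : Measurable (Function.uncurry J₀)) (hJ₀b : ∀ x y, |J₀ x y| ≤ CJ) (hΛ : 0 < Λ) (hη : 0 ≤ 1 + η)
    (hq : ∀ x ∈ S, ∫ y, M x y * Θ y ∂μ ≤ (1 + η) * Λ * (Θ x * w x)) (hν : ∀ x ∈ S, Θ x ^ 2 * w x ≤ Cν * D x) (hCν : 0 < Cν)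
    (hJ : ∀ x y, cJ * (Λ * J₀ x y) ≤ Θ x * M x y * Θ y) (hcJ : 0 < cJ) {P₀ ρ : ℝ} (hP₀ : 0 < P₀) (hrate : 1 / P₀ ≤ 1 - ρ)
    {x : X} (hx : x ∈ S) (hDx : 0 < D x) (hδ : δ < 1) (hmarg : (1 - δ) * D x ≤ ∫ y, J₀ x y ∂μ) :
    cJ / (Cν * P₀) ≤ (1 + η) * (1 - ρ) / (1 - δ) :=
  doorGain_le_flatRate (cJ_le_of_quasimode_of_comparison_at (μ := μ) hM hMb hΘb hΘ0 hΘ hJ₀ hJ₀b hΛ hη hq hν hJ hcJ hx hDx hmarg) hδ hη hCν hP₀ hrate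

end Summit.QuantumFields.YangMills.Theorems.TwistedTraceScaling.Negative.R62

end
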